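import Summits.BirchSwinnertonDyer.Rank1Residual.X11b.Three.LambdaSupply
import Summits.BirchSwinnertonDyer.Rank1Residual.X11b.Three.LambdaSupplyTwistFamily
import HarnessLib

set_option linter.dupNamespace false
set_option autoImplicit false

/-!
# Crux `EisensteinHeartFlatCMInertBadKPrime` (stmt-BirchSwinnertonDyer-21341), line `hsieh_lambda` v7 — stub R2
# `stub_rangeAvatar`: Hsieh's range on the `K′`-line is NON-EMPTY (Galois half)

Lead seat `bsd-wall-cm-bed-p1` g11 (`--supports stmt-BirchSwinnertonDyer-21341`; theorems only; nothing is closed; BSD is not proved).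

Skeleton v7 of the crux (`Cruxes/EisensteinHeartFlatCMInertBadKPrime/Lines/hsieh_lambda.lean`, sha16 7a0fae088e9a9fa9) isolates the
one input every proof of the crux must use — Hsieh's range
`R = {(χ, r) : χ everywhere unramified of type (n, −n), n ≥ 1, r a p-adic avatar of χ factoring through the anticyclotomic κ}`
is non-empty (on an empty range the crux's frame binder is vacuous and the divisibility is false). This file proves the GALOIS HALF,
the registered stub `stub_rangeAvatar`: for `K` imaginary quadratic, `p` odd, ANY anticyclotomic `ℤ_p`-extension `κ` and any
`ι : ℚ̄_p ≃ ℂ`, from ONE everywhere-unramified Hecke character `Ψ` of type `(k, −k)`, `k > 0`, the character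
`χ := Ψ^N · (Ψ^N ∘ c̄)⁻¹` (type `(2Nk, −2Nk)`, unramified everywhere) has a `p`-adic avatar `r` with `FactorsThroughZp κ r`.

Proof (every step a tree theorem of the `b2b-bsdres` cell's X11b/Three `LambdaSupply` toolkit, which is `p`-general; template
`LambdaSupply.exists_lambda_of_character` without its twisting step): a complex conjugation `c ∈ Γ_ℚ ∖ Γ_K`, `c² = 1`, its lift
`θ` to `Γ_K` (`ZpExtension.IndexTwo.exists_conjHom`); the rank-two spanning pair `Φ₀, Φ₁ : Γ_K →ₜ* ℤ_p`
(`LambdaSupply.exists_spanningPair` — the tree's PROVED `ℤ_p`-rank theorem for imaginary quadratic fields); Weil's character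
`a : Γ_K →* Eˣ` of `Ψ` in a finite `E/ℚ_p` (`LambdaSupply.exists_weilValued`); `n₁ > 0` with `a^{n₁}` principal-unit valued
(`PadicUnits.exists_pow_mem_of_isOpen`) and `M > 0` with `a^M = 1` on `ker Φ₀ ∩ ker Φ₁` (`PadicUnits.pow_eq_one_of_forall_character`:
logarithm + rank two — the torsion of `Gal(K^{ab,(p)}/K)` dies here, so NO class-number hypothesis); `u := a^{n₁M}`,
`g := u · (u ∘ θ)⁻¹` is anti-invariant, principal-unit valued and trivial on `ker Φ₀ ∩ ker Φ₁` (which `θ` preserves, by the spanning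
property), so `g` KILLS `ker κ` (`LambdaSupply.apply_eq_one_of_anti`: the `(-1)`-eigenline of `Hom(Γ_K, ℤ_p) ≅ ℤ_p²` is `ℤ_p κ`;
principal units have no element of order `2` for `p ≠ 2`); finally `χ := Ψ^N (Ψ^N ∘ c̄)⁻¹` has the avatar `e ∘ (ψ′ (ψ′ ∘ θ)⁻¹)`,
`ψ′ = ι_E ∘ u⁻¹` (`isPAdicAvatarOf_pow`, `isPAdicAvatarOf_mul_galConj_inv_of_finrank_eq_two`), which is `e ∘ ι_E ∘ g⁻¹` up to the
order of factors and therefore factors through `κ` (`factorsThroughZp_unitsChar_iff`). Infinity type and ramification of `χ`: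
`HasInfinityType.zpow' / galConj_complexConj / inv / mul'`, `isUnramifiedAt_pow' / isUnramifiedAt_galConj_iff / inv' / mul'`.

References: [Weil1956] §1–§2 (the `p`-adic avatar of a type-`A₀` character); [Greenberg1987] §2 (anticyclotomic characters as
quotients `Ψ/Ψ∘c`); [Washington1997] §13.1, Thm. 13.4 (`ℤ_p`-rank two); [Hsieh2014Crelle] Prop. 4.9 (the range of the `K′`-line).
-/

noncomputable section

open scoped NumberField
open NumberField IsDedekindDomain Field Filter Topology
  Literature.NumberTheory.GaloisRepresentations Literature.NumberTheory.EllipticCurves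
  Summit.BirchSwinnertonDyer.Rank1Residual.X11b.Three.LambdaSupply

namespace Summit.BirchSwinnertonDyer.BirchSwinnertonDyer.Theorems.BiquadraticEisensteinDescentEisensteinHeartFlatCMInertBadKPrimeRangeAvatar

/-- **Hsieh's range is non-empty — Galois half (core form, named hypotheses).** For `K` imaginary quadratic, `p` odd,
`κ` an anticyclotomic `ℤ_p`-extension, `ι : ℚ̄_p ≃ ℂ` and an everywhere-unramified Hecke character `Ψ` of infinity type
`(k, −k)` with `k > 0`: there are an everywhere-unramified `χ` of type `(n, −n)`, `n > 0`, and a `p`-adic avatar `r` of `χ`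
(`IsPAdicAvatarOf ι χ r`) factoring through `κ` (`FactorsThroughZp κ r`). See the module docstring for the proof.
[cite: Weil1956, §1–§2] [cite: Greenberg1987, §2] [cite: Washington1997, §13.1] -/
theorem exists_rangePoint_of_character {K : Type} [Field K] [NumberField K] {p : ℕ} [Fact p.Prime]
    (hK : IsImaginaryQuadratic K) (hp2 : p ≠ 2) (κ : ZpExtension K p) (hκ : κ.IsAnticyclotomic)
    (ι : PadicAlgCl p ≃+* ℂ) {Ψ : HeckeCharacter K} {k : ℕ} (hk : 0 < k)
    (hΨt : Ψ.HasInfinityType (fun _ ↦ (k : ℤ)) (fun _ ↦ -(k : ℤ)))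
    (hΨu : ∀ v : HeightOneSpectrum (𝓞 K), Ψ.IsUnramifiedAt v) :
    ∃ (χ : HeckeCharacter K) (n : ℕ) (r : FramedGaloisRep K (PadicAlgCl p) 1), 0 < n ∧
      (∀ v : HeightOneSpectrum (𝓞 K), χ.IsUnramifiedAt v) ∧
      χ.HasInfinityType (fun _ ↦ (n : ℤ)) (fun _ ↦ -(n : ℤ)) ∧
      IsPAdicAvatarOf ι χ r ∧ FactorsThroughZp κ r := by
  classical
  haveI : IsTotallyComplex K := hK.2
  haveI : Algebra.IsQuadraticExtension ℚ K := { finrank_eq_two' := hK.1 }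
  haveI : IsGalois ℚ K := inferInstance
  haveI : IsCMField K := IsCMField.ofCMExtension ℚ K
  have himag : ∀ w : InfinitePlace K, w.IsComplex := fun w => IsTotallyComplex.isComplex w
  -- the currency `e : ℚ̄_pˣ ≃ GL₁(ℚ̄_p)`
  set e := (FramedRep.unitsContinuousMulEquivOfUnique (Fin 1) (PadicAlgCl p) :
    (PadicAlgCl p)ˣ →ₜ* GL (Fin 1) (PadicAlgCl p)) with he
  -- Step 1: `c`, its lift `θ`, and the rank-two spanning pair
  obtain ⟨c, hc, hc2⟩ := exists_not_mem_range_absGaloisRestrict (L := K) (Rat.castHom ℝ) himag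
  have hinj := absGaloisRestrict_injective ℚ K
  have hidx : ∀ ρ ρ' : absoluteGaloisGroup ℚ, ρ ∉ Set.range (absGaloisRestrict ℚ K) →
      ρ' ∉ Set.range (absGaloisRestrict ℚ K) → ρ⁻¹ * ρ' ∈ Set.range (absGaloisRestrict ℚ K) :=
    fun ρ ρ' hρ hρ' => inv_mul_mem_range_absGaloisRestrict hK.1 hρ hρ'
  obtain ⟨θ, hθ⟩ := ZpExtension.IndexTwo.exists_conjHom (absGaloisRestrict ℚ K) hinj hidx c
  have hθθ : ∀ σ, θ (θ σ) = σ := ZpExtension.IndexTwo.conjHom_conjHom hinj hc2 hθ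
  obtain ⟨Φ₀, Φ₁, hsurj, hspan⟩ := exists_spanningPair (p := p) hK.1 himag
  -- Step 2: Weil's character of `Ψ` with values in a finite `E/ℚ_p`, and the avatar `e ∘ ψa⁻¹`
  have hΨa : Ψ.IsAlgebraic := (Ψ.isAlgebraic_iff_exists_hasInfinityType).mpr ⟨_, _, hΨt⟩
  have hΨu' : ∀ v : HeightOneSpectrum (𝓞 K), ((p : ℕ) : 𝓞 K) ∉ v.asIdeal → Ψ.IsUnramifiedAt v :=
    fun v _ => hΨu v
  obtain ⟨E, hEfd, a, ha, haΨ⟩ := exists_weilValued ι hΨa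
  haveI : CompleteSpace E := FiniteDimensional.complete ℚ_[p] E
  set ιE : (E)ˣ →* (PadicAlgCl p)ˣ :=
    Units.map ((algebraMap E (PadicAlgCl p) : E →+* PadicAlgCl p) : E →* PadicAlgCl p) with hιE
  obtain ⟨ψa, hψa⟩ := exists_unitsChar_of_continuous (p := p) a ha
  have hψa' : ∀ σ, ψa σ = ιE (a σ) := fun σ => Units.ext (hψa σ)
  have hΨav : IsPAdicAvatarOf ι Ψ (e.comp ψa⁻¹) := by
    rw [isPAdicAvatarOf_unitsChar_iff]
    intro v hv hu
    obtain ⟨h1, h2⟩ := haΨ v hv hu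
    refine ⟨fun 𝔓 h𝔓 σ hσ => ?_, fun 𝔓 h𝔓 Φ hΦ => ?_⟩
    · rw [unitsChar_inv_apply, hψa', h1 𝔓 h𝔓 σ hσ, map_one, inv_one]
    · rw [unitsChar_inv_apply, Units.val_inv_eq_inv_val, hψa, h2 𝔓 h𝔓 Φ hΦ]
  -- Step 3: the principal units `P ≤ Eˣ` and the exponents `n₁` (into `P`) and `M` (killing the common kernel)
  obtain ⟨P, hP⟩ := PadicUnits.exists_principalUnits (F := E)
  have hPopen : IsOpen (P : Set (E)ˣ) := by
    have hPeq : (P : Set (E)ˣ) = {x : (E)ˣ | ‖1 - ((x : (E)ˣ) : E)‖ < 1} := Set.ext fun x => hP x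
    rw [hPeq]
    exact PadicUnits.isOpen_setOf_norm_one_sub_lt (F := E)
  obtain ⟨n₁, hn₁, hmem⟩ := PadicUnits.exists_pow_mem_of_isOpen a ha P hPopen
  obtain ⟨M, hM, hMker⟩ := PadicUnits.pow_eq_one_of_forall_character (p := p) (F := E) Φ₀ Φ₁ hspan a ha
  set N : ℕ := n₁ * M with hNdef
  have hNpos : 0 < N := Nat.mul_pos hn₁ hM
  set u : absoluteGaloisGroup K →* (E)ˣ := (powMonoidHom N).comp a with hu
  have hu_apply : ∀ σ, u σ = (a σ) ^ N := fun σ => rfl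
  have huP : ∀ σ, u σ ∈ P := fun σ => by
    rw [hu_apply, hNdef, pow_mul]
    exact P.pow_mem (hmem σ) M
  have huker : ∀ σ, Φ₀ σ = 1 → Φ₁ σ = 1 → u σ = 1 := fun σ h0 h1 => by
    rw [hu_apply, hNdef, mul_comm, pow_mul, hMker σ h0 h1, one_pow]
  -- `θ` preserves the common kernel of the `ℤ_p`-characters (spanning property)
  have hθker : ∀ σ, Φ₀ σ = 1 → Φ₁ σ = 1 → Φ₀ (θ σ) = 1 ∧ Φ₁ (θ σ) = 1 := by
    intro σ h0 h1
    have h0' : (Φ₀ σ).toAdd = 0 := by rw [h0]; rfl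
    have h1' : (Φ₁ σ).toAdd = 0 := by rw [h1]; rfl
    obtain ⟨a₀, b₀, e₀⟩ := hspan (Φ₀.comp θ)
    obtain ⟨a₁, b₁, e₁⟩ := hspan (Φ₁.comp θ)
    have f0 := e₀ σ
    have f1 := e₁ σ
    rw [ContinuousMonoidHom.coe_comp, Function.comp_apply, h0', h1', mul_zero, mul_zero, add_zero] at f0 f1
    exact ⟨toAdd_eq_zero.mp f0, toAdd_eq_zero.mp f1⟩
  -- the anti-invariant character `g = u / (u ∘ θ)`
  set g : absoluteGaloisGroup K →* (E)ˣ := u * (u.comp θ.toMonoidHom)⁻¹ with hg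
  have hg_apply : ∀ σ, g σ = u σ * (u (θ σ))⁻¹ := fun σ => rfl
  have hgN : ∀ σ, Φ₀ σ = 1 → Φ₁ σ = 1 → g σ = 1 := fun σ h0 h1 => by
    obtain ⟨h0', h1'⟩ := hθker σ h0 h1
    rw [hg_apply, huker σ h0 h1, huker _ h0' h1', inv_one, mul_one]
  have hanti : ∀ σ, g (θ σ) = (g σ)⁻¹ := fun σ => by
    rw [hg_apply, hg_apply, hθθ, mul_inv_rev, inv_inv]
  have hgP : ∀ σ, g σ ∈ P := fun σ => P.mul_mem (huP σ) (P.inv_mem (huP _))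
  -- LEMMA Λ′: `g` kills `ker κ`
  have hgκ : ∀ σ, κ σ = 1 → g σ = 1 := fun σ hσ =>
    apply_eq_one_of_anti hK.1 κ hκ hc hc2 hθ hsurj hspan g hgN hanti (P : Set (E)ˣ)
      (fun x hx hxx => Units.ext (PadicUnits.eq_one_of_mul_self_eq_one (p := p) hp2 ((hP x).mp hx)
        (by rw [← Units.val_mul, hxx, Units.val_one])))
      (fun τ _ => hgP τ) σ hσ
  -- Step 4: `Ψ′ = Ψ^N` and its avatar `e ∘ ψ′`, `ψ′ = (ψa⁻¹)^N = ι_E ∘ u⁻¹`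
  set Ψ' : HeckeCharacter K := Ψ ^ N with hΨ'
  set ψ' : absoluteGaloisGroup K →ₜ* (PadicAlgCl p)ˣ := ψa⁻¹ ^ N with hψ'def
  have hΨ'u_all : ∀ v : HeightOneSpectrum (𝓞 K), Ψ'.IsUnramifiedAt v := fun v => isUnramifiedAt_pow' (hΨu v) N
  have hΨ'u : ∀ v : HeightOneSpectrum (𝓞 K), ((p : ℕ) : 𝓞 K) ∉ v.asIdeal → Ψ'.IsUnramifiedAt v :=
    fun v _ => hΨ'u_all v
  have hΨ'av : IsPAdicAvatarOf ι Ψ' (e.comp ψ') := isPAdicAvatarOf_pow ι hΨav hΨu' N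
  have hψ'_apply : ∀ τ, ψ' τ = ιE (u τ)⁻¹ := fun τ => by
    simp only [hψ'def, ContinuousMonoidHom.pow_apply, unitsChar_inv_apply, hψa', hu_apply, map_pow, map_inv,
      inv_pow]
  -- Step 5: `χ := Ψ′ (Ψ′ ∘ c̄)⁻¹`, `r := e ∘ (ψ′ (ψ′∘θ)⁻¹)`
  set σc : K ≃ₐ[ℚ] K := (IsCMField.complexConj K).restrictScalars ℚ with hσcdef
  have hσc : σc ≠ 1 := restrictScalars_complexConj_ne_one
  -- infinity type of `Ψ′` and of the quotient
  have hΨ't : Ψ'.HasInfinityType (fun _ ↦ ((N * k : ℕ) : ℤ)) (fun _ ↦ -((N * k : ℕ) : ℤ)) := by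
    have h := hΨt.zpow' (N : ℤ)
    have hs1 : ((N : ℤ) • fun _ : InfinitePlace K ↦ (k : ℤ)) = fun _ ↦ ((N * k : ℕ) : ℤ) := by
      funext w; simp only [Pi.smul_apply, smul_eq_mul]; push_cast; ring
    have hs2 : ((N : ℤ) • fun _ : InfinitePlace K ↦ -(k : ℤ)) = fun _ ↦ -((N * k : ℕ) : ℤ) := by
      funext w; simp only [Pi.smul_apply, smul_eq_mul]; push_cast; ring
    rw [zpow_natCast, hs1, hs2] at h
    exact h
  have hΨ'c : (HeckeCharacter.galConj σc Ψ').HasInfinityType (fun _ ↦ -((N * k : ℕ) : ℤ))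
      (fun _ ↦ ((N * k : ℕ) : ℤ)) :=
    hΨ't.galConj_complexConj
  have hquot := hΨ't.mul' hΨ'c.inv
  have e1 : ((fun _ : InfinitePlace K ↦ ((N * k : ℕ) : ℤ)) + -fun _ : InfinitePlace K ↦ -((N * k : ℕ) : ℤ)) =
      fun _ ↦ ((2 * (N * k) : ℕ) : ℤ) := by funext w; push_cast; simp; ring
  have e2 : ((fun _ : InfinitePlace K ↦ -((N * k : ℕ) : ℤ)) + -fun _ : InfinitePlace K ↦ ((N * k : ℕ) : ℤ)) =
      fun _ ↦ -((2 * (N * k) : ℕ) : ℤ) := by funext w; push_cast; simp; ring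
  rw [e1, e2] at hquot
  refine ⟨Ψ' * (HeckeCharacter.galConj σc Ψ')⁻¹, 2 * (N * k), e.comp (ψ' * (ψ'.comp θ)⁻¹),
    Nat.mul_pos two_pos (Nat.mul_pos hNpos hk), fun v => ?_, hquot,
    isPAdicAvatarOf_mul_galConj_inv_of_finrank_eq_two hK.1 ι hΨ'av hΨ'u hc hθ hσc, ?_⟩
  · -- unramified everywhere
    exact (hΨ'u_all v).mul' ((HeckeCharacter.isUnramifiedAt_galConj_iff σc Ψ' v).mpr (hΨ'u_all _)).inv'
  · -- factorisation through `κ`: `ψ′ (ψ′∘θ)⁻¹ = ι_E ∘ g⁻¹`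
    rw [factorsThroughZp_unitsChar_iff]
    intro σ hσ
    rw [ContinuousMonoidHom.mul_apply, unitsChar_inv_apply, ContinuousMonoidHom.coe_comp,
      Function.comp_apply, hψ'_apply, hψ'_apply, ← map_inv ιE, inv_inv, ← map_mul ιE,
      show (u σ)⁻¹ * u (θ σ) = (g σ)⁻¹ by rw [hg_apply, mul_inv_rev, inv_inv, mul_comm], hgκ σ hσ, inv_one,
      map_one]

/-- **STUB `stub_rangeAvatar` of skeleton v7 of crux `EisensteinHeartFlatCMInertBadKPrime` (line `hsieh_lambda`)**, proved:
the registered signature verbatim (`K` imaginary quadratic, `p ≠ 2`, `κ` anticyclotomic, `ι′`, `Ψ` everywhere unramified of type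
`(k, −k)`, `k > 0` ⟹ a point `(χ, r)` of Hsieh's range through `κ`). `= exists_rangePoint_of_character`.
[cite: Weil1956, §1–§2] [cite: Greenberg1987, §2] [cite: Washington1997, §13.1] -/
theorem stub_rangeAvatar :
    ∀ (K : Type) [Field K] [NumberField K] (p : ℕ) [Fact p.Prime], IsImaginaryQuadratic K → p ≠ 2 →
      ∀ (κ : ZpExtension K p), κ.IsAnticyclotomic → ∀ (ι' : PadicAlgCl p ≃+* ℂ) (Ψ : HeckeCharacter K) (k : ℕ), 0 < k →
        Ψ.HasInfinityType (fun _ ↦ (k : ℤ)) (fun _ ↦ -(k : ℤ)) →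
        (∀ v : HeightOneSpectrum (𝓞 K), Ψ.IsUnramifiedAt v) →
        ∃ (χ : HeckeCharacter K) (n : ℕ) (r : FramedGaloisRep K (PadicAlgCl p) 1), 0 < n ∧
          (∀ v : HeightOneSpectrum (𝓞 K), χ.IsUnramifiedAt v) ∧
          χ.HasInfinityType (fun _ ↦ (n : ℤ)) (fun _ ↦ -(n : ℤ)) ∧
          IsPAdicAvatarOf ι' χ r ∧ FactorsThroughZp κ r :=
  fun _ _ _ _ _ hK hp2 κ hκ ι' _ _ hk hΨt hΨu => exists_rangePoint_of_character hK hp2 κ hκ ι' hk hΨt hΨu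

end Summit.BirchSwinnertonDyer.BirchSwinnertonDyer.Theorems.BiquadraticEisensteinDescentEisensteinHeartFlatCMInertBadKPrimeRangeAvatar

end
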